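import Summits.KontsevichZagierPeriods.KontsevichZagierPeriods.Theorems.FurushoPentagonDoubleShuffleInKZRiderLeverAux

/-!
# `DoubleShuffleInKZ` (stmt-KontsevichZagierPeriods-14665, route `FurushoPentagon`): the rider lever

Helper file (`--supports stmt-KontsevichZagierPeriods-14665`), line "rider lever" for the
Kaneko–Yamamoto integral–series family `IS_j(u)` (to which the item is equivalent,
`IntegralSeries.doubleShuffleInKZ_of_integralSeriesFamily`).  This file is the ANALYTIC CORE, stated
abstractly (no multiple zeta values): the dilation lever of the `HoffmanRelationInKZ` line
(`stub_peakExists`, `stub_descents`) at an ARBITRARY active coordinate `i₀` of `ℝᴺ`, over an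
arbitrary `ℚ`-semialgebraic cylinder `P` of passive coordinates, with a semialgebraic floor
`c` (in the application: the top rider `u₀` of a chain `x_q > u₀ > u₁ > ⋯` hanging below the cubical
coordinate `x_q = w i₀`; the other riders and the other cubical coordinates are passive).

THE LEVER (`rider_lever`).  Let `f, k` be functions on `B = {w ∈ P | 0 < w i₀ < 1}` with
`∂_b (b · f(w|_{i₀ := b})) = k(w|_{i₀ := b}) ≥ 0` on `(0,1)` and `b ↦ b f(w|_{i₀:=b})` continuous on
`[0,1)`.  If the END representation `[B, f(w) − c(w) f(w|_{i₀ := c(w) w_{i₀}})]` exists, then the START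
representation `[{w ∈ B | c(w) < w i₀}, f]` exists and the two differ by an element of
`KZ.relations`: Newton–Leibniz along an appended dilation variable `λ ∈ [0,1]`
(primitive `λ f(w|_{i₀ := λ w_{i₀}})`, kernel `k(w|_{i₀ := λ w_{i₀}})`, which depends on `λ w_{i₀}`
only), the FREE transposition `λ ↔ w_{i₀}` (a coordinate permutation), and Newton–Leibniz back
along `λ ∈ [c(w), 1]`; all intermediate representations are absolutely convergent (Tonelli along
`λ`, the kernel being `≥ 0`).  [Kontsevich–Zagier 2001, §1.2, rules (1)–(3).]

References: M. Kontsevich, D. Zagier, *Periods* (2001), §1.2; M. E. Hoffman, Pacific J. Math. 152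
(1992), Thm 5.1; M. Kaneko, S. Yamamoto, Selecta Math. 24 (2018), Thm 4.1.
-/

noncomputable section

open Set MeasureTheory Function
open Literature.NumberTheory.Transcendental
open Literature.ModelTheory.ExponentialFields (IsSemialgebraic)

namespace Summit.KontsevichZagierPeriods.FurushoPentagon.DoubleShuffleInKZ

variable {N : ℕ}

/-! ### 4. The lever -/

/-- **The rider lever** (abstract dilation lever of the `HoffmanRelationInKZ` line at an arbitrary
active coordinate `i₀`, over a `ℚ`-semialgebraic cylinder `P` of passive coordinates, with a
semialgebraic floor `0 < c < 1` independent of `w i₀`).  Hypotheses: on `P`, `b ↦ b f(w|_{i₀ := b})`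
is continuous on `[0,1)` with derivative `k(w|_{i₀ := b}) ≥ 0` on `(0,1)`; `f, k` are
`ℚ`-semialgebraic on `{w ∈ P | 0 ≤ w i₀ < 1}`; and the END representation
`[{w ∈ P | 0 < w i₀ < 1}, f(w) − c(w) f(w|_{i₀ := c(w) w i₀})]` exists.  Conclusion: the START
representation `[{w ∈ P | 0 < w i₀ < 1, c(w) < w i₀}, f]` exists, and START − END ∈ `KZ.relations`
(Newton–Leibniz along an appended dilation variable `λ ∈ [0,1]`, the transposition `λ ↔ w i₀`, and
Newton–Leibniz back along `λ ∈ [c(w), 1]`; absolute convergence of the intermediates by Tonelli,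
`k ≥ 0`). [cite: KontsevichZagier2001, §1.2] -/
theorem rider_lever (i₀ : Fin N) (P : Set (Fin N → ℝ)) (hPsa : IsSemialgebraic ℚ P)
    (hPupd : ∀ w ∈ P, ∀ b : ℝ, update w i₀ b ∈ P)
    (c f k : (Fin N → ℝ) → ℝ)
    (hcsa : IsSemialgebraicFunOn ℚ P c) (hcupd : ∀ (w : Fin N → ℝ) (b : ℝ), c (update w i₀ b) = c w)
    (hc : ∀ w ∈ P, c w ∈ Ioo (0:ℝ) 1)
    (hfsa : IsSemialgebraicFunOn ℚ {w | w ∈ P ∧ w i₀ ∈ Ico (0:ℝ) 1} f)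
    (hksa : IsSemialgebraicFunOn ℚ {w | w ∈ P ∧ w i₀ ∈ Ico (0:ℝ) 1} k)
    (hder : ∀ w ∈ P, ∀ b ∈ Ioo (0:ℝ) 1,
      HasDerivAt (fun b : ℝ => b * f (update w i₀ b)) (k (update w i₀ b)) b)
    (hcont : ∀ w ∈ P, ContinuousOn (fun b : ℝ => b * f (update w i₀ b)) (Ico 0 1))
    (hk0 : ∀ w ∈ P, ∀ b ∈ Ioo (0:ℝ) 1, 0 ≤ k (update w i₀ b))
    (hend : ∃ r' : KZ.IntegralRep N, r'.domain = {w | w ∈ P ∧ w i₀ ∈ Ioo (0:ℝ) 1} ∧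
      EqOn r'.integrand (fun w => f w - c w * f (update w i₀ (c w * w i₀))) r'.domain) :
    (∃ r : KZ.IntegralRep N, r.domain = {w | w ∈ P ∧ w i₀ ∈ Ioo (0:ℝ) 1 ∧ c w < w i₀} ∧
      EqOn r.integrand f r.domain) ∧
    ∀ (r r' : KZ.IntegralRep N), r.domain = {w | w ∈ P ∧ w i₀ ∈ Ioo (0:ℝ) 1 ∧ c w < w i₀} →
      EqOn r.integrand f r.domain → r'.domain = {w | w ∈ P ∧ w i₀ ∈ Ioo (0:ℝ) 1} →
      EqOn r'.integrand (fun w => f w - c w * f (update w i₀ (c w * w i₀))) r'.domain →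
      KZ.of r - KZ.of r' ∈ KZ.relations := by
  -- ### the sets
  set B : Set (Fin N → ℝ) := {w | w ∈ P ∧ w i₀ ∈ Ioo (0:ℝ) 1} with hB_def
  set B₀ : Set (Fin N → ℝ) := {w | w ∈ P ∧ w i₀ ∈ Ico (0:ℝ) 1} with hB₀_def
  set D : Set (Fin N → ℝ) := {w | w ∈ P ∧ w i₀ ∈ Ioo (0:ℝ) 1 ∧ c w < w i₀} with hD_def
  have hpos : IsSemialgebraic ℚ {w : Fin N → ℝ | 0 < w i₀} := by
    simpa using Literature.ModelTheory.ExponentialFields.isSemialgebraic_setOf_eval_pos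
      (k := ℚ) (R := ℝ) (MvPolynomial.X i₀ : MvPolynomial (Fin N) ℚ)
  have hnn : IsSemialgebraic ℚ {w : Fin N → ℝ | 0 ≤ w i₀} := by
    simpa using Literature.ModelTheory.ExponentialFields.isSemialgebraic_setOf_eval_le
      (k := ℚ) (R := ℝ) (0 : MvPolynomial (Fin N) ℚ) (MvPolynomial.X i₀)
  have hlt1 : IsSemialgebraic ℚ {w : Fin N → ℝ | w i₀ < 1} := by
    simpa using Literature.ModelTheory.ExponentialFields.isSemialgebraic_setOf_eval_lt
      (k := ℚ) (R := ℝ) (MvPolynomial.X i₀ : MvPolynomial (Fin N) ℚ) 1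
  have hBsa : IsSemialgebraic ℚ B := by
    convert (hPsa.inter hpos).inter hlt1 using 1
    ext w; simp only [hB_def, mem_setOf_eq, mem_inter_iff, mem_Ioo]; tauto
  have hB₀sa : IsSemialgebraic ℚ B₀ := by
    convert (hPsa.inter hnn).inter hlt1 using 1
    ext w; simp only [hB₀_def, mem_setOf_eq, mem_inter_iff, mem_Ico]; tauto
  have hDsa : IsSemialgebraic ℚ D := by
    have hg : IsSemialgebraicFunOn ℚ P (fun w => c w - w i₀) :=
      IsSemialgebraicFunOn.sub_holds hcsa (isSemialgebraicFunOn_apply hPsa i₀)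
    have h := hg.isSemialgebraic_sep_lt
      Literature.ModelTheory.ExponentialFields.tarski_seidenberg_real_holds 0 0
    convert hBsa.inter h using 1
    ext w
    simp only [hD_def, hB_def, mem_setOf_eq, mem_inter_iff, Nat.cast_zero, zero_add, one_mul,
      Int.cast_zero, sub_neg]
    tauto
  have hDB : D ⊆ B := fun w hw => ⟨hw.1, hw.2.1⟩
  have hBB₀ : B ⊆ B₀ := fun w hw => ⟨hw.1, hw.2.1.le, hw.2.2⟩
  have hcB : IsSemialgebraicFunOn ℚ B c := hcsa.mono (fun w hw => hw.1) hBsa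
  -- ### the dilation map `φ(w, λ) = w|_{i₀ := λ w i₀}`, the primitive `F` and the kernel `k₁`
  set φ : (Fin (N + 1) → ℝ) → (Fin N → ℝ) := fun z =>
    update (Fin.init z) i₀ (z (Fin.last N) * Fin.init z i₀) with hφ_def
  set F : (Fin (N + 1) → ℝ) → ℝ := fun z => z (Fin.last N) * f (φ z) with hF_def
  set k₁ : (Fin (N + 1) → ℝ) → ℝ := fun z => k (φ z) with hk₁_def
  have hφ_snoc : ∀ (w : Fin N → ℝ) (t : ℝ), φ (Fin.snoc w t) = update w i₀ (t * w i₀) := by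
    intro w t; simp [hφ_def, Fin.init_snoc, Fin.snoc_last]
  have hF_snoc : ∀ (w : Fin N → ℝ) (t : ℝ), F (Fin.snoc w t) = t * f (update w i₀ (t * w i₀)) := by
    intro w t; simp [hF_def, hφ_snoc, Fin.snoc_last]
  have hk₁_snoc : ∀ (w : Fin N → ℝ) (t : ℝ), k₁ (Fin.snoc w t) = k (update w i₀ (t * w i₀)) := by
    intro w t; simp [hk₁_def, hφ_snoc]
  have hφsa : ∀ {S : Set (Fin (N + 1) → ℝ)}, IsSemialgebraic ℚ S → IsSemialgebraicMapOn ℚ S φ := by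
    intro S hS
    classical
    refine (isSemialgebraicMapOn_aeval hS (fun j : Fin N =>
      if j = i₀ then (MvPolynomial.X (Fin.last N) * MvPolynomial.X (Fin.castSucc i₀) :
        MvPolynomial (Fin (N + 1)) ℚ) else MvPolynomial.X (Fin.castSucc j))).congr fun z _ => ?_
    funext j
    by_cases hj : j = i₀
    · subst hj
      simp [hφ_def, Fin.init]
    · simp [hφ_def, hj, Fin.init]
  -- the two bands
  set bU : Set (Fin (N + 1) → ℝ) := KZlog.band D (fun _ => 0) (fun _ => 1) with hbU_def
  set bD : Set (Fin (N + 1) → ℝ) := KZlog.band B c (fun _ => 1) with hbD_def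
  have hφU : MapsTo φ bU B₀ := by
    intro z hz
    obtain ⟨hzD, hz0, hz1⟩ := KZlog.mem_band.1 hz
    have ha := hzD.2.1
    refine ⟨hPupd _ hzD.1 _, ?_⟩
    simp only [hφ_def, update_self]
    exact ⟨mul_nonneg hz0 ha.1.le, by nlinarith [ha.2, ha.1]⟩
  have hφD : MapsTo φ bD B₀ := by
    intro z hz
    obtain ⟨hzB, hzc, hz1⟩ := KZlog.mem_band.1 hz
    have ha := hzB.2
    have hc0 : 0 < c (Fin.init z) := (hc _ hzB.1).1
    refine ⟨hPupd _ hzB.1 _, ?_⟩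
    simp only [hφ_def, update_self]
    exact ⟨(mul_pos (hc0.trans_le hzc) ha.1).le, by nlinarith [ha.2, ha.1]⟩
  have hbUsa : IsSemialgebraic ℚ bU :=
    KZlog.isSemialgebraic_band (by simpa using isSemialgebraicFunOn_ratCast hDsa 0)
      (by simpa using isSemialgebraicFunOn_ratCast hDsa 1)
  have hbDsa : IsSemialgebraic ℚ bD :=
    KZlog.isSemialgebraic_band hcB (by simpa using isSemialgebraicFunOn_ratCast hBsa 1)
  have hk₁U : IsSemialgebraicFunOn ℚ bU k₁ :=
    IsSemialgebraicFunOn.comp_isSemialgebraicMapOn_holds hksa (hφsa hbUsa) hφU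
  have hk₁D : IsSemialgebraicFunOn ℚ bD k₁ :=
    IsSemialgebraicFunOn.comp_isSemialgebraicMapOn_holds hksa (hφsa hbDsa) hφD
  have hFU : IsSemialgebraicFunOn ℚ bU F :=
    IsSemialgebraicFunOn.mul_holds (isSemialgebraicFunOn_apply hbUsa (Fin.last N))
      (IsSemialgebraicFunOn.comp_isSemialgebraicMapOn_holds hfsa (hφsa hbUsa) hφU)
  have hFD : IsSemialgebraicFunOn ℚ bD F :=
    IsSemialgebraicFunOn.mul_holds (isSemialgebraicFunOn_apply hbDsa (Fin.last N))
      (IsSemialgebraicFunOn.comp_isSemialgebraicMapOn_holds hfsa (hφsa hbDsa) hφD)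
  -- ### fibrewise calculus
  have hfib : ∀ w ∈ B, ∀ s : ℝ, 0 ≤ s → s ≤ 1 →
      IntegrableOn (fun l : ℝ => k (update w i₀ (l * w i₀))) (Icc s 1) ∧
      ∫ l in Icc s 1, k (update w i₀ (l * w i₀)) = f w - s * f (update w i₀ (s * w i₀)) := by
    intro w hw s hs0 hs1
    have h := lever_fibre_integral i₀ f k w hw.2.1 hw.2.2 (hder w hw.1) (hcont w hw.1)
      (hk0 w hw.1) hs0 hs1
    rwa [update_eq_self] at h
  have hlfib : ∀ w ∈ B, ∀ s : ℝ, 0 ≤ s → s ≤ 1 →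
      ∫⁻ l in Icc s 1, ‖k₁ (Fin.snoc w l)‖ₑ = ENNReal.ofReal (f w - s * f (update w i₀ (s * w i₀))) := by
    intro w hw s hs0 hs1
    obtain ⟨hint, hval⟩ := hfib w hw s hs0 hs1
    have ha := hw.2
    have hnn : ∀ l ∈ Ioc s 1, 0 ≤ k (update w i₀ (l * w i₀)) := fun l hl =>
      hk0 w hw.1 _ ⟨mul_pos (hs0.trans_lt hl.1) ha.1, by nlinarith [hl.2, ha.2, ha.1]⟩
    simp_rw [hk₁_snoc]
    rw [setLIntegral_congr Ioc_ae_eq_Icc.symm,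
      setLIntegral_congr_fun measurableSet_Ioc (fun l hl => Real.enorm_eq_ofReal (hnn l hl)),
      ← ofReal_integral_eq_lintegral_ofReal (hint.mono_set Ioc_subset_Icc_self)
        ((ae_restrict_mem measurableSet_Ioc).mono hnn),
      ← integral_Icc_eq_integral_Ioc, hval]
  -- ### the END representation and the band over `B` (Tonelli)
  obtain ⟨rE, hrEdom, hrEint⟩ := hend
  have hBm : MeasurableSet B := IsSemialgebraic.measurableSet_holds hBsa
  have hDm : MeasurableSet D := IsSemialgebraic.measurableSet_holds hDsa
  have hbDm : MeasurableSet bD := IsSemialgebraic.measurableSet_holds hbDsa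
  have hbUm : MeasurableSet bU := IsSemialgebraic.measurableSet_holds hbUsa
  have hEint : IntegrableOn (fun w => f w - c w * f (update w i₀ (c w * w i₀))) B := by
    have h := rE.integrableOn
    rw [hrEdom] at h hrEint
    exact h.congr_fun hrEint hBm
  have hk₁D_int : IntegrableOn k₁ bD := by
    refine KZlog.integrableOn_band_of_lintegral_fibre_le hBm hbDm (fun x t => KZlog.snoc_mem_band)
      (KZ.aestronglyMeasurable_of_isSemialgebraicFunOn hk₁D hbDm) (fun w hw => ?_) hEint
    rw [hlfib w hw (c w) (hc w hw.1).1.le (hc w hw.1).2.le]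
    exact Real.ofReal_le_enorm _
  -- the band representation over `B` and its transpose
  let rbD : KZ.IntegralRep (N + 1) := ⟨bD, k₁, hbDsa, hk₁D, hk₁D_int⟩
  let e : Fin (N + 1) ≃ Fin (N + 1) := Equiv.swap (Fin.castSucc i₀) (Fin.last N)
  have hlast : Fin.castSucc i₀ ≠ Fin.last N := (Fin.castSucc_lt_last i₀).ne
  have he_cs : e (Fin.castSucc i₀) = Fin.last N := Equiv.swap_apply_left _ _
  have he_last : e (Fin.last N) = Fin.castSucc i₀ := Equiv.swap_apply_right _ _
  have he_other : ∀ j : Fin N, j ≠ i₀ → e (Fin.castSucc j) = Fin.castSucc j := fun j hj =>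
    Equiv.swap_apply_of_ne_of_ne (fun h => hj (Fin.castSucc_injective _ h)) (Fin.castSucc_lt_last j).ne
  have hinit_e : ∀ z : Fin (N + 1) → ℝ, Fin.init (fun i => z (e i)) = update (Fin.init z) i₀ (z (Fin.last N)) := by
    intro z; funext j
    by_cases hj : j = i₀
    · subst hj; simp [Fin.init, he_cs]
    · simp [Fin.init, he_other j hj, hj]
  have hφe : ∀ z : Fin (N + 1) → ℝ, φ (fun i => z (e i)) = φ z := by
    intro z
    simp only [hφ_def, hinit_e, he_last, update_idem, update_self]
    congr 1
    simp only [Fin.init]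
    ring
  let rSw : KZ.IntegralRep (N + 1) := rbD.reindex e
  have hrSw_int : rSw.integrand = k₁ := by
    funext z
    show k₁ (fun i => z (e i)) = k₁ z
    simp only [hk₁_def, hφe]
  have hrSw_dom : rSw.domain = {z : Fin (N + 1) → ℝ | Fin.init z ∈ P ∧ z (Fin.last N) ∈ Ioo (0:ℝ) 1 ∧
      c (Fin.init z) ≤ Fin.init z i₀ ∧ Fin.init z i₀ ≤ 1} := by
    ext z
    show (fun i => z (e i)) ∈ bD ↔ _
    rw [hbD_def, KZlog.mem_band, hinit_e, hcupd, he_last]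
    simp only [hB_def, mem_setOf_eq, update_self]
    constructor
    · rintro ⟨⟨hP, hl⟩, h1, h2⟩
      refine ⟨?_, hl, h1, h2⟩
      have := hPupd _ hP (Fin.init z i₀)
      rwa [update_idem, update_eq_self] at this
    · rintro ⟨hP, hl, h1, h2⟩
      exact ⟨⟨hPupd _ hP _, hl⟩, h1, h2⟩
  -- ### integrability on the band over `D`, and of `f` on `D`
  have hZ0 : volume {z : Fin (N + 1) → ℝ | z (Fin.last N) = 0} = 0 := volume_setOf_apply_eq_const _ _
  have hZ1 : volume {z : Fin (N + 1) → ℝ | z (Fin.last N) = 1} = 0 := volume_setOf_apply_eq_const _ _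
  have hUsub : bU \ rSw.domain ⊆ {z | z (Fin.last N) = 0} ∪ {z | z (Fin.last N) = 1} := by
    intro z hz
    obtain ⟨hzU, hzS⟩ := hz
    obtain ⟨hzD, hz0, hz1⟩ := KZlog.mem_band.1 hzU
    rw [hrSw_dom] at hzS
    simp only [mem_setOf_eq, not_and, not_le] at hzS
    by_contra hne
    simp only [mem_union, mem_setOf_eq, not_or] at hne
    have hl : z (Fin.last N) ∈ Ioo (0:ℝ) 1 :=
      ⟨lt_of_le_of_ne hz0 (Ne.symm hne.1), lt_of_le_of_ne hz1 hne.2⟩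
    exact absurd (hzS hzD.1 hl hzD.2.2.le) (not_lt.mpr hzD.2.1.2.le)
  have hk₁U_int : IntegrableOn k₁ bU := by
    have h1 : IntegrableOn k₁ rSw.domain := by
      have := rSw.integrableOn
      rwa [hrSw_int] at this
    have h2 : IntegrableOn k₁ ({z : Fin (N + 1) → ℝ | z (Fin.last N) = 0} ∪ {z | z (Fin.last N) = 1}) := by
      rw [IntegrableOn, Measure.restrict_eq_zero.mpr (measure_union_null hZ0 hZ1)]
      exact integrable_zero_measure
    exact (h1.union h2).mono_set fun z hz => by
      by_cases h : z ∈ rSw.domain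
      · exact Or.inl h
      · exact Or.inr (hUsub ⟨hz, h⟩)
  have hfD_nonneg : ∀ w ∈ B, 0 ≤ f w := by
    intro w hw
    obtain ⟨-, hval⟩ := hfib w hw 0 le_rfl zero_le_one
    rw [zero_mul, sub_zero] at hval
    rw [← hval, integral_Icc_eq_integral_Ioc]
    exact setIntegral_nonneg measurableSet_Ioc fun l hl =>
      hk0 w hw.1 _ ⟨mul_pos hl.1 hw.2.1, by nlinarith [hl.2, hw.2.2, hw.2.1]⟩
  have hfD_int : IntegrableOn f D := by
    have hfD' : IsSemialgebraicFunOn ℚ D f := hfsa.mono (fun w hw => hBB₀ (hDB hw)) hDsa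
    refine ⟨KZ.aestronglyMeasurable_of_isSemialgebraicFunOn hfD' hDm, ?_⟩
    rw [HasFiniteIntegral]
    have h1 : ∫⁻ w in D, ‖f w‖ₑ = ∫⁻ w in D, ∫⁻ l in Icc ((fun _ => (0:ℝ)) w) ((fun _ => (1:ℝ)) w),
        ‖k₁ (Fin.snoc w l)‖ₑ := by
      refine setLIntegral_congr_fun hDm fun w hw => ?_
      rw [hlfib w (hDB hw) 0 le_rfl zero_le_one, zero_mul, sub_zero,
        Real.enorm_eq_ofReal (hfD_nonneg w (hDB hw))]
    rw [h1, ← lintegral_band_eq hDm hbUm (fun x t => KZlog.snoc_mem_band)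
      (KZ.aestronglyMeasurable_of_isSemialgebraicFunOn hk₁U hbUm)]
    exact hk₁U_int.2
  -- ### the START representation exists
  have hfD : IsSemialgebraicFunOn ℚ D f := hfsa.mono (fun w hw => hBB₀ (hDB hw)) hDsa
  let rS : KZ.IntegralRep N := ⟨D, f, hDsa, hfD, hfD_int⟩
  refine ⟨⟨rS, rfl, fun _ _ => rfl⟩, ?_⟩
  -- ### the moves
  intro r r' hrdom hrint hr'dom hr'int
  -- Newton–Leibniz along `λ ∈ [0, 1]` over `D`
  have hFends : ∀ w : Fin N → ℝ, F (Fin.snoc w 1) - F (Fin.snoc w 0) = f w := by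
    intro w; rw [hF_snoc, hF_snoc, one_mul, one_mul, update_eq_self, zero_mul, sub_zero]
  obtain ⟨rb₁, rd₁, hrb₁dom, hrb₁int, hrd₁dom, hrd₁int, hNL₁⟩ :=
    KZ.exists_band_newtonLeibniz hDsa (fun _ => 0) (fun _ => 1)
      (by simpa using isSemialgebraicFunOn_ratCast hDsa 0)
      (by simpa using isSemialgebraicFunOn_ratCast hDsa 1) (fun _ _ => zero_le_one) F k₁ hFU hk₁U
      (fun w hw => by
        simp_rw [hF_snoc]
        exact lever_scaled_continuousOn i₀ f w (hDB hw).2.1 (hDB hw).2.2 (hcont w hw.1))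
      (fun w hw t ht => by
        simp_rw [hF_snoc, hk₁_snoc]
        exact lever_scaled_hasDerivAt i₀ f k w (hDB hw).2.1 (hder w hw.1) ht.1
          (by nlinarith [ht.2, (hDB hw).2.2, (hDB hw).2.1]))
      hk₁U_int
      (hfD.congr fun w _ => (hFends w).symm)
      (hfD_int.congr_fun (fun w _ => (hFends w).symm) hDm)
  -- `r ≡ rd₁` (same domain `D`, integrands agree there)
  have h_r_rd₁ : KZ.of r - KZ.of rd₁ ∈ KZ.relations := by
    refine KZ.of_sub_of_mem_relations_of_eqOn (by rw [hrd₁dom, hrdom]) fun w hw => ?_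
    rw [hrd₁int, hrint hw]
    exact (hFends w).symm
  -- `rb₁ ≡ rSw` (domains differ by null sets, same integrand `k₁`)
  have hE₀ : volume {w : Fin N → ℝ | w ∈ P ∧ w i₀ = c w} = 0 :=
    volume_sep_apply_eq_floor_eq_zero i₀ hPsa hcsa hcupd
  have hZc : volume {z : Fin (N + 1) → ℝ | Fin.init z ∈ {w : Fin N → ℝ | w ∈ P ∧ w i₀ = c w}} = 0 :=
    KZ.volume_setOf_init_mem_eq_zero hE₀
  have hZi : volume {z : Fin (N + 1) → ℝ | z (Fin.castSucc i₀) = 1} = 0 :=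
    volume_setOf_apply_eq_const _ _
  have h_rb₁_rSw : KZ.of rb₁ - KZ.of rSw ∈ KZ.relations := by
    refine KZ.of_sub_of_mem_relations_of_null rb₁ rSw ?_ ?_ (fun z _ => by rw [hrb₁int, hrSw_int])
    · rw [hrb₁dom]
      exact measure_mono_null hUsub (measure_union_null hZ0 hZ1)
    · refine measure_mono_null (fun z hz => ?_) (measure_union_null hZi hZc)
      obtain ⟨hzS, hzU⟩ := hz
      rw [hrSw_dom] at hzS
      obtain ⟨hP, hl, h1, h2⟩ := hzS
      rw [hrb₁dom] at hzU
      by_contra hne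
      simp only [mem_union, mem_setOf_eq, not_or] at hne
      have hc0 := (hc _ hP).1
      have hi1 : Fin.init z i₀ < 1 := lt_of_le_of_ne h2 hne.1
      have hic : c (Fin.init z) < Fin.init z i₀ := lt_of_le_of_ne h1 (fun h => hne.2 ⟨hP, h.symm⟩)
      exact hzU (KZlog.mem_band.2 ⟨⟨hP, ⟨hc0.trans hic, hi1⟩, hic⟩, hl.1.le, hl.2.le⟩)
  -- `rbD ≡ rSw` (coordinate permutation)
  have h_rbD_rSw : KZ.of rbD - KZ.of rSw ∈ KZ.relations := KZ.of_sub_of_reindex_mem_relations rbD e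
  -- Newton–Leibniz along `λ ∈ [c w, 1]` over `B`
  obtain ⟨rb₂, rd₂, hrb₂dom, hrb₂int, hrd₂dom, hrd₂int, hNL₂⟩ :=
    KZ.exists_band_newtonLeibniz hBsa c (fun _ => 1) hcB
      (by simpa using isSemialgebraicFunOn_ratCast hBsa 1) (fun w hw => (hc w hw.1).2.le) F k₁ hFD hk₁D
      (fun w hw => by
        simp_rw [hF_snoc]
        exact (lever_scaled_continuousOn i₀ f w hw.2.1 hw.2.2 (hcont w hw.1)).mono
          (Icc_subset_Icc_left (hc w hw.1).1.le))
      (fun w hw t ht => by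
        simp_rw [hF_snoc, hk₁_snoc]
        exact lever_scaled_hasDerivAt i₀ f k w hw.2.1 (hder w hw.1) ((hc w hw.1).1.trans ht.1)
          (by nlinarith [ht.2, hw.2.2, hw.2.1]))
      hk₁D_int
      ((rE.isSemialgebraicFunOn_integrand.congr hrEint).mono (by rw [hrEdom]) hBsa |>.congr
        fun w _ => by simp only [hF_snoc, one_mul, update_eq_self])
      (hEint.congr_fun (fun w _ => by simp only [hF_snoc, one_mul, update_eq_self]) hBm)
  have h_rb₂_rbD : KZ.of rb₂ - KZ.of rbD ∈ KZ.relations :=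
    KZ.of_sub_of_mem_relations_of_eqOn (by rw [hrb₂dom]) fun z _ => by rw [hrb₂int]
  have h_rd₂_r' : KZ.of rd₂ - KZ.of r' ∈ KZ.relations := by
    refine KZ.of_sub_of_mem_relations_of_eqOn (by rw [hr'dom, hrd₂dom]) fun w hw => ?_
    rw [hrd₂dom] at hw
    rw [hrd₂int, hr'int (by rw [hr'dom]; exact hw)]
    simp only [hF_snoc, one_mul, update_eq_self]
  -- assemble the chain `r ≡ rd₁ ≡ rb₁ ≡ rSw ≡ rbD ≡ rb₂ ≡ rd₂ ≡ r'`
  have key : KZ.of r - KZ.of r' = (KZ.of r - KZ.of rd₁) - (KZ.of rb₁ - KZ.of rd₁) +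
      (KZ.of rb₁ - KZ.of rSw) - (KZ.of rbD - KZ.of rSw) - (KZ.of rb₂ - KZ.of rbD) +
      (KZ.of rb₂ - KZ.of rd₂) + (KZ.of rd₂ - KZ.of r') := by abel
  rw [key]
  refine KZ.relations.add_mem (KZ.relations.add_mem (KZ.relations.sub_mem (KZ.relations.sub_mem
    (KZ.relations.add_mem (KZ.relations.sub_mem h_r_rd₁ hNL₁) h_rb₁_rSw) h_rbD_rSw) h_rb₂_rbD) hNL₂)
    h_rd₂_r'

end Summit.KontsevichZagierPeriods.FurushoPentagon.DoubleShuffleInKZ
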